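import Literature.NumberTheory.Automorphic.IntegralWeightHeckeModuleGL2
import Literature.NumberTheory.Automorphic.ArithmeticQuotientHeckeTwoLevel
import HarnessLib

/-!
# Change of coefficients in the "coefficients at `p`" model: push-forward along an equivariant
# map, and the weight-raising map of independence of weight

Topic `NumberTheory/Automorphic`; namespace `Literature.NumberTheory.Automorphic.LevelAction`;
a complement to `IntegralWeightHeckeModuleGL2` (the model `M(U, τ) = sections Δ τ U` of
`U`-equivariant `V`-valued functions on `𝒢` with its Hecke operators `heckeOp`, and its cohomology
`cohomology ι Δ τ U i = H^i(Γ, M(U, τ))`).  Vocabulary and the GENERIC half of **independence of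
weight** ([KhareThorne2017, §6.4, Prop. 6.13]; [Hida1994AIF, §2, Prop. 2.1]), transposed to the
cochain/cohomology side, for the proof of Hida's control theorem
(`hidaControl_dominantOrdinaryPoint`):

* `pushforward` — for two `Δ`-modules `(V, τ)`, `(V', τ')` and an EQUIVARIANT linear map
  `φ : V → V'` (`φ ∘ τ(δ) = τ'(δ) ∘ φ`), composition `f ↦ φ ∘ f` maps `M(U, τ) → M(U, τ')`, is a
  morphism of `Γ`-representations and commutes with every Hecke operator `[U β U]`
  (`compLeft_heckeOp`, `heckeRepHom_comp_pushforward`, `heckeCohomology_comp_pushforwardCohomology`).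
  (Instance: `φ = λ₁`, the `X₁^m`-coefficient `Sym^m(𝒪/ϖ^r) → 𝒪/ϖ^r(χ)`, `SymPowOrdinaryLine`.)
* `raiseFun ψ α`, `raise` — for a (NON-equivariant) linear map `ψ : V' → V` and `α ∈ Δ`, the
  **weight-raising operator** `Θ f = ∑_{d ∈ UαU/U} d̃ · (ψ ∘ f)`, i.e.
  `(Θ f)(g) = ∑_d τ(d̃) ψ(f(g d̃))` (KT's `φ` / Hida's twisted trace, transposed).  Under the two
  hypotheses of [KhareThorne2017, proof of Prop. 6.13] —
  `hsplit : φ ∘ ψ = id` and `hfac : τ(y) ∘ ψ ∘ φ = τ(y)` for every `y` in the double coset `U α U`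
  ("`τ(y)` sees only `φ`": the representatives of `U_p^r` kill `ker λ₁` modulo `ϖ^r`) — `Θ` is
  independent of the representatives on sections (`act_mul_compLeft_apply_of_mem_sections`), maps
  `M(U, τ')` to `M(U, τ)` (`raiseFun_apply_mem_sections`), is `Γ`-equivariant, and satisfies
  **`φ_* ∘ Θ = [U α U]` on `M(U, τ')` and `Θ ∘ φ_* = [U α U]` on `M(U, τ)`**
  (`compLeft_raiseFun`, `raiseFun_compLeft`; as morphisms of representations
  `raise_comp_pushforward`, `pushforward_comp_raise`; on cohomology
  `raiseCohomology_comp_pushforwardCohomology`, `pushforwardCohomology_comp_raiseCohomology`).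
  Hence `φ_*` is a bijection between the `[UαU]`-ordinary parts whenever `[UαU]` acts bijectively on
  them (abstract Hida lemma `bijOn_of_comp_eq` of `ArithmeticQuotientHeckeTwoLevel`): independence
  of weight.

## References

* C. Khare, J. A. Thorne, *Potential automorphy and the Leopoldt conjecture*, Amer. J. Math. 139
  (2017), §6.4, Prop. 6.13 and its proof (arXiv:1409.7007, held; read 2026-08-16). [KhareThorne2017]
* H. Hida, *p-adic ordinary Hecke algebras for GL(2)*, Ann. Inst. Fourier 44 (1994), §2, Prop. 2.1
  (held). [Hida1994AIF]
-/

noncomputable section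

open CategoryTheory

universe u

namespace Literature.NumberTheory.Automorphic.LevelAction

variable {R : Type u} [CommRing R] {Γ 𝒢 : Type u} [Group Γ] [Group 𝒢] (ι : Γ →* 𝒢)
  (Δ : Submonoid 𝒢) {V V' : Type u} [AddCommGroup V] [Module R V] [AddCommGroup V'] [Module R V']
  (τ : Δ →* Module.End R V) (τ' : Δ →* Module.End R V') (U : Subgroup 𝒢)

/-! ### Push-forward along an equivariant map of coefficients -/

section Pushforward

variable (φ : V →ₗ[R] V')

/-- Composition with an equivariant `φ` intertwines the actions on functions. [folklore] -/
theorem compLeft_fnAction (hφ : ∀ δ : Δ, φ ∘ₗ τ δ = τ' δ ∘ₗ φ) (δ : Δ) (f : 𝒢 → V) :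
    φ.compLeft 𝒢 (fnAction Δ τ δ f) = fnAction Δ τ' δ (φ.compLeft 𝒢 f) := by
  funext g
  simp only [LinearMap.compLeft_apply, Function.comp_apply, fnAction_apply]
  exact LinearMap.congr_fun (hφ δ) _

/-- Composition with an equivariant `φ` commutes with `act`. [folklore] -/
theorem compLeft_act (hφ : ∀ δ : Δ, φ ∘ₗ τ δ = τ' δ ∘ₗ φ) (x : 𝒢) (f : 𝒢 → V) :
    φ.compLeft 𝒢 (act Δ (fnAction Δ τ) x f) = act Δ (fnAction Δ τ') x (φ.compLeft 𝒢 f) := by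
  by_cases hx : x ∈ Δ
  · rw [act_of_mem hx, act_of_mem hx]
    exact compLeft_fnAction Δ τ τ' φ hφ ⟨x, hx⟩ f
  · rw [act_of_not_mem hx, act_of_not_mem hx, LinearMap.zero_apply, LinearMap.zero_apply, map_zero]

/-- **Composition with an equivariant `φ` commutes with the Hecke operators `[U β U]`.** [folklore] -/
theorem compLeft_heckeOp (hφ : ∀ δ : Δ, φ ∘ₗ τ δ = τ' δ ∘ₗ φ) (β : 𝒢) (f : 𝒢 → V) :
    φ.compLeft 𝒢 (heckeOp Δ (fnAction Δ τ) U β f) = heckeOp Δ (fnAction Δ τ') U β (φ.compLeft 𝒢 f) := by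
  classical
  by_cases h : (ArithmeticQuotient.doubleCosetQuot U β).Finite
  · rw [heckeOp_eq_sum h, heckeOp_eq_sum h, LinearMap.sum_apply, LinearMap.sum_apply, map_sum]
    exact Finset.sum_congr rfl fun d _ => compLeft_act Δ τ τ' φ hφ d.out f
  · rw [heckeOp_eq_zero_of_infinite h, heckeOp_eq_zero_of_infinite h, LinearMap.zero_apply,
      LinearMap.zero_apply, map_zero]

/-- Composition with an equivariant `φ` maps `M(U, τ)` to `M(U, τ')`. [folklore] -/
theorem compLeft_mem_sections (hφ : ∀ δ : Δ, φ ∘ₗ τ δ = τ' δ ∘ₗ φ) {f : 𝒢 → V}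
    (hf : f ∈ sections Δ τ U) : φ.compLeft 𝒢 f ∈ sections Δ τ' U := fun u hu => by
  rw [← compLeft_act Δ τ τ' φ hφ, hf u hu]

/-- Composition with `φ` commutes with left translations. [folklore] -/
theorem compLeft_leftTranslation (γ : Γ) (f : 𝒢 → V) :
    φ.compLeft 𝒢 (leftTranslation R ι V γ f) = leftTranslation R ι V' γ (φ.compLeft 𝒢 f) :=
  rfl

/-- **Push-forward of sections along an equivariant map of coefficients `φ`**, `f ↦ φ ∘ f`, a
morphism `M(U, τ) ⟶ M(U, τ')` of `Γ`-representations. [cite: KhareThorne2017, §6.4 (β_𝛌)] -/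
def pushforward (hφ : ∀ δ : Δ, φ ∘ₗ τ δ = τ' δ ∘ₗ φ) :
    Rep.of (rep ι Δ τ U) ⟶ Rep.of (rep ι Δ τ' U) :=
  Rep.ofHom ⟨(φ.compLeft 𝒢).restrict fun _ hf => compLeft_mem_sections Δ τ τ' U φ hφ hf, fun γ =>
    LinearMap.ext fun f => Subtype.ext (by
      simp only [LinearMap.coe_comp, Function.comp_apply, LinearMap.coe_restrict_apply, coe_rep_apply]
      rfl)⟩

/-- Unfolding lemma for `pushforward`. [folklore] -/
@[simp]
theorem pushforward_hom_apply_coe (hφ : ∀ δ : Δ, φ ∘ₗ τ δ = τ' δ ∘ₗ φ) (f : sections Δ τ U) :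
    (((pushforward ι Δ τ τ' U φ hφ).hom f : sections Δ τ' U) : 𝒢 → V') = φ.compLeft 𝒢 f :=
  rfl

/-- **Push-forward commutes with the Hecke operators** (as morphisms of representations).
[folklore] -/
theorem heckeRepHom_comp_pushforward (hφ : ∀ δ : Δ, φ ∘ₗ τ δ = τ' δ ∘ₗ φ) (hU : U.toSubmonoid ≤ Δ)
    {β : 𝒢} (hβ : β ∈ Δ) :
    heckeRepHom ι Δ τ U hU hβ ≫ pushforward ι Δ τ τ' U φ hφ =
      pushforward ι Δ τ τ' U φ hφ ≫ heckeRepHom ι Δ τ' U hU hβ :=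
  Rep.hom_ext (Representation.IntertwiningMap.ext (LinearMap.ext fun f => Subtype.ext
    (compLeft_heckeOp Δ τ τ' U φ hφ β f)))

/-- **Push-forward on cohomology** `H^i(U, τ) ⟶ H^i(U, τ')`. [cite: KhareThorne2017, §6.4] -/
abbrev pushforwardCohomology (hφ : ∀ δ : Δ, φ ∘ₗ τ δ = τ' δ ∘ₗ φ) (i : ℕ) :
    cohomology ι Δ τ U i ⟶ cohomology ι Δ τ' U i :=
  groupCohomology.map (MonoidHom.id Γ) (pushforward ι Δ τ τ' U φ hφ) i

/-- **Push-forward on cohomology commutes with the Hecke operators.** [folklore] -/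
theorem heckeCohomology_comp_pushforwardCohomology (hφ : ∀ δ : Δ, φ ∘ₗ τ δ = τ' δ ∘ₗ φ)
    (hU : U.toSubmonoid ≤ Δ) {β : 𝒢} (hβ : β ∈ Δ) (i : ℕ) :
    (pushforwardCohomology ι Δ τ τ' U φ hφ i).hom ∘ₗ heckeCohomology ι Δ τ U hU hβ i =
      heckeCohomology ι Δ τ' U hU hβ i ∘ₗ (pushforwardCohomology ι Δ τ τ' U φ hφ i).hom := by
  dsimp only [heckeCohomology, pushforwardCohomology]
  rw [← ModuleCat.hom_comp, ← ModuleCat.hom_comp, ← groupCohomology.map_id_comp,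
    ← groupCohomology.map_id_comp, heckeRepHom_comp_pushforward ι Δ τ τ' U φ hφ hU hβ]

end Pushforward

/-! ### The weight-raising operator -/

section Raise

variable (ψ : V' →ₗ[R] V) (α : 𝒢)

open scoped Classical in
/-- **The weight-raising operator `Θ_{ψ,α} f = ∑_{d ∈ UαU/U} d̃ · (ψ ∘ f)`** on functions:
`(Θ f)(g) = ∑_d τ(d̃) ψ(f(g d̃))` — the Hecke sum `[U α U]` with the non-equivariant map of
coefficients `ψ` inserted (on sections and under the factorisation hypothesis this is independent
of the representatives `d̃`).  Transpose of the map `φ`/`α_{𝛌,*}` of the proof of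
[cite: KhareThorne2017, §6.4, Prop. 6.13].  Junk value `0` when `UαU/U` is infinite. -/
def raiseFun : (𝒢 → V') →ₗ[R] (𝒢 → V) :=
  if h : (ArithmeticQuotient.doubleCosetQuot U α).Finite then
    ∑ d ∈ h.toFinset, act Δ (fnAction Δ τ) d.out ∘ₗ ψ.compLeft 𝒢
  else 0

variable {Δ τ τ' U ψ α}

open scoped Classical in
/-- Unfolding lemma for `raiseFun` in the finite case. [folklore] -/
theorem raiseFun_eq_sum (h : (ArithmeticQuotient.doubleCosetQuot U α).Finite) :
    raiseFun Δ τ U ψ α = ∑ d ∈ h.toFinset, act Δ (fnAction Δ τ) d.out ∘ₗ ψ.compLeft 𝒢 := by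
  rw [raiseFun, dif_pos h]

/-- The documented junk value. [folklore] -/
theorem raiseFun_eq_zero_of_infinite (h : ¬ (ArithmeticQuotient.doubleCosetQuot U α).Finite) :
    raiseFun Δ τ U ψ α = 0 := by
  rw [raiseFun, dif_neg h]

variable {φ : V →ₗ[R] V'}

/-- From `φ ∘ ψ = id`, `τ(y) ∘ ψ ∘ φ = τ(y)` and the equivariance of `φ`: `τ(y)` does not see the
failure of `ψ` to be equivariant — `τ(y) τ(u) ψ = τ(y) ψ τ'(u)`. [folklore] -/
theorem apply_apply_psi_eq (hφ : ∀ δ : Δ, φ ∘ₗ τ δ = τ' δ ∘ₗ φ) (hsplit : φ ∘ₗ ψ = LinearMap.id)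
    {y : Δ} (hfac : τ y ∘ₗ (ψ ∘ₗ φ) = τ y) (u : Δ) (x : V') :
    τ y (τ u (ψ x)) = τ y (ψ (τ' u x)) := by
  have h1 : τ y (ψ (φ (τ u (ψ x)))) = τ y (τ u (ψ x)) := LinearMap.congr_fun hfac (τ u (ψ x))
  have h2 : φ (τ u (ψ x)) = τ' u (φ (ψ x)) := LinearMap.congr_fun (hφ u) (ψ x)
  have h3 : φ (ψ x) = x := LinearMap.congr_fun hsplit x
  rw [← h1, h2, h3]

/-- **Independence of the representative**: on `F ∈ M(U, τ')`, `(y u) · (ψ ∘ F) = y · (ψ ∘ F)` for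
`y ∈ Δ` with `τ(y) ∘ ψ ∘ φ = τ(y)` and `u ∈ U ⊆ Δ`. [cite: KhareThorne2017, §6.4, proof of Prop. 6.13] -/
theorem act_mul_compLeft_apply_of_mem_sections (hφ : ∀ δ : Δ, φ ∘ₗ τ δ = τ' δ ∘ₗ φ)
    (hsplit : φ ∘ₗ ψ = LinearMap.id) (hU : U.toSubmonoid ≤ Δ) {F : 𝒢 → V'}
    (hF : F ∈ sections Δ τ' U) {y u : 𝒢} (hy : y ∈ Δ) (hfac : τ ⟨y, hy⟩ ∘ₗ (ψ ∘ₗ φ) = τ ⟨y, hy⟩)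
    (hu : u ∈ U) :
    act Δ (fnAction Δ τ) (y * u) (ψ.compLeft 𝒢 F) = act Δ (fnAction Δ τ) y (ψ.compLeft 𝒢 F) := by
  rw [act_mul hy (hU hu), Module.End.mul_apply, act_of_mem hy, act_of_mem (hU hu)]
  funext g
  simp only [fnAction_apply, LinearMap.compLeft_apply, Function.comp_apply]
  have hmul : τ (⟨y, hy⟩ * ⟨u, hU hu⟩) = τ ⟨y, hy⟩ * τ ⟨u, hU hu⟩ := map_mul τ _ _
  rw [apply_apply_psi_eq hφ hsplit hfac ⟨u, hU hu⟩, (mem_sections_iff hU).1 hF (g * y) u hu]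

/-- On `F ∈ M(U, τ')`, `d̃ · (ψ ∘ F) = y · (ψ ∘ F)` for any representative `y ∈ Δ` of `d = yU`
satisfying the factorisation hypothesis. [folklore] -/
theorem act_out_compLeft_apply_eq (hφ : ∀ δ : Δ, φ ∘ₗ τ δ = τ' δ ∘ₗ φ)
    (hsplit : φ ∘ₗ ψ = LinearMap.id) (hU : U.toSubmonoid ≤ Δ) {F : 𝒢 → V'}
    (hF : F ∈ sections Δ τ' U) {y : 𝒢} (hy : y ∈ Δ) (hfac : τ ⟨y, hy⟩ ∘ₗ (ψ ∘ₗ φ) = τ ⟨y, hy⟩)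
    (d : 𝒢 ⧸ U) (hyd : (y : 𝒢 ⧸ U) = d) :
    act Δ (fnAction Δ τ) d.out (ψ.compLeft 𝒢 F) = act Δ (fnAction Δ τ) y (ψ.compLeft 𝒢 F) := by
  obtain ⟨u, hu⟩ : ∃ u : U, d.out = y * u := by
    refine ⟨⟨y⁻¹ * d.out, ?_⟩, by simp⟩
    rw [← QuotientGroup.eq, hyd, QuotientGroup.out_eq']
  rw [hu, act_mul_compLeft_apply_of_mem_sections hφ hsplit hU hF hy hfac u.2]

variable (Δ τ U) in
/-- The factorisation hypothesis along a whole double coset `U α U`: `τ(y) ∘ ψ ∘ φ = τ(y)` for every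
`y ∈ Δ` whose coset lies in `UαU/U` ("`τ(y)` sees only `φ`"). [cite: KhareThorne2017, §6.4, proof of Prop. 6.13] -/
abbrev HeckeFactorsThrough (φ : V →ₗ[R] V') (ψ : V' →ₗ[R] V) (α : 𝒢) : Prop :=
  ∀ (y : 𝒢) (hy : y ∈ Δ), (y : 𝒢 ⧸ U) ∈ ArithmeticQuotient.doubleCosetQuot U α →
    τ ⟨y, hy⟩ ∘ₗ (ψ ∘ₗ φ) = τ ⟨y, hy⟩

open scoped Classical in
/-- **`Θ` maps `M(U, τ')` into `M(U, τ)`** (`α ∈ Δ ⊇ U`, factorisation along `UαU`):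
`v · ∑_d d̃ · (ψ∘F) = ∑_d (v d̃) · (ψ∘F)` and `v d̃` represents `v • d`, a permutation of `UαU/U`.
[cite: KhareThorne2017, §6.4, proof of Prop. 6.13] -/
theorem raiseFun_apply_mem_sections (hφ : ∀ δ : Δ, φ ∘ₗ τ δ = τ' δ ∘ₗ φ)
    (hsplit : φ ∘ₗ ψ = LinearMap.id) (hU : U.toSubmonoid ≤ Δ) (hα : α ∈ Δ)
    (hfac : HeckeFactorsThrough Δ τ U φ ψ α) {F : 𝒢 → V'} (hF : F ∈ sections Δ τ' U) :
    raiseFun Δ τ U ψ α F ∈ sections Δ τ U := by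
  by_cases h : (ArithmeticQuotient.doubleCosetQuot U α).Finite
  swap
  · rw [raiseFun_eq_zero_of_infinite h, LinearMap.zero_apply]
    exact Submodule.zero_mem _
  intro v hv
  rw [raiseFun_eq_sum h, LinearMap.sum_apply, map_sum]
  simp only [LinearMap.comp_apply]
  have hterm : ∀ d ∈ h.toFinset,
      act Δ (fnAction Δ τ) v (act Δ (fnAction Δ τ) d.out (ψ.compLeft 𝒢 F)) =
        act Δ (fnAction Δ τ) ((v : 𝒢) • d).out (ψ.compLeft 𝒢 F) := by
    intro d hd
    rw [Set.Finite.mem_toFinset] at hd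
    have hdΔ : d.out ∈ Δ := out_mem_of_mem_doubleCosetQuot hU hα hd
    have hvd : v * d.out ∈ Δ := Δ.mul_mem (hU hv) hdΔ
    rw [← Module.End.mul_apply, ← act_mul (hU hv) hdΔ]
    refine (act_out_compLeft_apply_eq hφ hsplit hU hF hvd (hfac _ hvd ?_) _ ?_).symm
    · have : (((v * d.out : 𝒢)) : 𝒢 ⧸ U) = (v : 𝒢) • d := by
        conv_rhs => rw [← QuotientGroup.out_eq' d]
        rfl
      rw [this]
      exact ArithmeticQuotient.coe_smul_mem_doubleCosetQuot hd ⟨v, hv⟩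
    · conv_rhs => rw [← QuotientGroup.out_eq' d]
      rfl
  rw [Finset.sum_congr rfl hterm]
  exact ArithmeticQuotient.sum_doubleCosetQuot_coe_smul h ⟨v, hv⟩
    fun d => act Δ (fnAction Δ τ) d.out (ψ.compLeft 𝒢 F)

open scoped Classical in
/-- **`φ_* ∘ Θ = [U α U]` on `M(U, τ')`**: `φ(τ(d̃) ψ(F(g d̃))) = τ'(d̃) φ(ψ(F(g d̃))) = τ'(d̃) F(g d̃)`
(`φ` equivariant, `φ ψ = 1`). [cite: KhareThorne2017, §6.4, proof of Prop. 6.13] -/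
theorem compLeft_raiseFun (hφ : ∀ δ : Δ, φ ∘ₗ τ δ = τ' δ ∘ₗ φ) (hsplit : φ ∘ₗ ψ = LinearMap.id)
    (F : 𝒢 → V') :
    φ.compLeft 𝒢 (raiseFun Δ τ U ψ α F) = heckeOp Δ (fnAction Δ τ') U α F := by
  by_cases h : (ArithmeticQuotient.doubleCosetQuot U α).Finite
  swap
  · rw [raiseFun_eq_zero_of_infinite h, heckeOp_eq_zero_of_infinite h, LinearMap.zero_apply,
      LinearMap.zero_apply, map_zero]
  rw [raiseFun_eq_sum h, heckeOp_eq_sum h, LinearMap.sum_apply, LinearMap.sum_apply, map_sum]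
  refine Finset.sum_congr rfl fun d _ => ?_
  rw [LinearMap.comp_apply, compLeft_act Δ τ τ' φ hφ]
  congr 1
  funext g
  simp only [LinearMap.compLeft_apply, Function.comp_apply]
  exact LinearMap.congr_fun hsplit (F g)

open scoped Classical in
/-- **`Θ ∘ φ_* = [U α U]` on `M(U, τ)`** (indeed on all functions): `τ(d̃) ψ(φ(f(g d̃))) = τ(d̃) f(g d̃)`
by the factorisation hypothesis for the representatives `d̃ ∈ UαU`.
[cite: KhareThorne2017, §6.4, proof of Prop. 6.13] -/
theorem raiseFun_compLeft (hU : U.toSubmonoid ≤ Δ) (hα : α ∈ Δ) (hfac : HeckeFactorsThrough Δ τ U φ ψ α)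
    (f : 𝒢 → V) :
    raiseFun Δ τ U ψ α (φ.compLeft 𝒢 f) = heckeOp Δ (fnAction Δ τ) U α f := by
  by_cases h : (ArithmeticQuotient.doubleCosetQuot U α).Finite
  swap
  · rw [raiseFun_eq_zero_of_infinite h, heckeOp_eq_zero_of_infinite h, LinearMap.zero_apply,
      LinearMap.zero_apply]
  rw [raiseFun_eq_sum h, heckeOp_eq_sum h, LinearMap.sum_apply, LinearMap.sum_apply]
  refine Finset.sum_congr rfl fun d hd => ?_
  rw [Set.Finite.mem_toFinset] at hd
  have hdΔ : d.out ∈ Δ := out_mem_of_mem_doubleCosetQuot hU hα hd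
  rw [LinearMap.comp_apply, act_of_mem hdΔ]
  funext g
  simp only [fnAction_apply, LinearMap.compLeft_apply, Function.comp_apply]
  exact LinearMap.congr_fun (hfac _ hdΔ (by rw [QuotientGroup.out_eq']; exact hd)) (f (g * d.out))

open scoped Classical in
/-- `Θ` commutes with left translations. [folklore] -/
theorem raiseFun_leftTranslation (γ : Γ) (F : 𝒢 → V') :
    raiseFun Δ τ U ψ α (leftTranslation R ι V' γ F) = leftTranslation R ι V γ (raiseFun Δ τ U ψ α F) := by
  by_cases h : (ArithmeticQuotient.doubleCosetQuot U α).Finite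
  · rw [raiseFun_eq_sum h, LinearMap.sum_apply, LinearMap.sum_apply, map_sum]
    refine Finset.sum_congr rfl fun d _ => ?_
    rw [LinearMap.comp_apply, LinearMap.comp_apply, ← act_leftTranslation ι Δ τ d.out γ]
    rfl
  · rw [raiseFun_eq_zero_of_infinite h, LinearMap.zero_apply, LinearMap.zero_apply, map_zero]

variable (Δ τ τ' U φ ψ α)

/-- **The weight-raising morphism `Θ : M(U, τ') ⟶ M(U, τ)` of `Γ`-representations.**
[cite: KhareThorne2017, §6.4, proof of Prop. 6.13] -/
def raise (hφ : ∀ δ : Δ, φ ∘ₗ τ δ = τ' δ ∘ₗ φ) (hsplit : φ ∘ₗ ψ = LinearMap.id)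
    (hU : U.toSubmonoid ≤ Δ) (hα : α ∈ Δ) (hfac : HeckeFactorsThrough Δ τ U φ ψ α) :
    Rep.of (rep ι Δ τ' U) ⟶ Rep.of (rep ι Δ τ U) :=
  Rep.ofHom ⟨(raiseFun Δ τ U ψ α).restrict fun _ hF =>
      raiseFun_apply_mem_sections hφ hsplit hU hα hfac hF, fun γ =>
    LinearMap.ext fun F => Subtype.ext (by
      simp only [LinearMap.coe_comp, Function.comp_apply, LinearMap.coe_restrict_apply, coe_rep_apply]
      exact raiseFun_leftTranslation ι γ (F : 𝒢 → V'))⟩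

/-- Unfolding lemma for `raise`. [folklore] -/
@[simp]
theorem raise_hom_apply_coe (hφ : ∀ δ : Δ, φ ∘ₗ τ δ = τ' δ ∘ₗ φ) (hsplit : φ ∘ₗ ψ = LinearMap.id)
    (hU : U.toSubmonoid ≤ Δ) (hα : α ∈ Δ) (hfac : HeckeFactorsThrough Δ τ U φ ψ α) (F : sections Δ τ' U) :
    (((raise ι Δ τ τ' U ψ α φ hφ hsplit hU hα hfac).hom F : sections Δ τ U) : 𝒢 → V) =
      raiseFun Δ τ U ψ α F :=
  rfl

/-- **`Θ ≫ φ_* = [U α U]` on `M(U, τ')`** (morphisms of representations).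
[cite: KhareThorne2017, §6.4, Prop. 6.13] -/
theorem raise_comp_pushforward (hφ : ∀ δ : Δ, φ ∘ₗ τ δ = τ' δ ∘ₗ φ)
    (hsplit : φ ∘ₗ ψ = LinearMap.id) (hU : U.toSubmonoid ≤ Δ) (hα : α ∈ Δ)
    (hfac : HeckeFactorsThrough Δ τ U φ ψ α) :
    raise ι Δ τ τ' U ψ α φ hφ hsplit hU hα hfac ≫ pushforward ι Δ τ τ' U φ hφ =
      heckeRepHom ι Δ τ' U hU hα :=
  Rep.hom_ext (Representation.IntertwiningMap.ext (LinearMap.ext fun F => Subtype.ext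
    (compLeft_raiseFun hφ hsplit (F : 𝒢 → V'))))

/-- **`φ_* ≫ Θ = [U α U]` on `M(U, τ)`** (morphisms of representations).
[cite: KhareThorne2017, §6.4, Prop. 6.13] -/
theorem pushforward_comp_raise (hφ : ∀ δ : Δ, φ ∘ₗ τ δ = τ' δ ∘ₗ φ)
    (hsplit : φ ∘ₗ ψ = LinearMap.id) (hU : U.toSubmonoid ≤ Δ) (hα : α ∈ Δ)
    (hfac : HeckeFactorsThrough Δ τ U φ ψ α) :
    pushforward ι Δ τ τ' U φ hφ ≫ raise ι Δ τ τ' U ψ α φ hφ hsplit hU hα hfac =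
      heckeRepHom ι Δ τ U hU hα :=
  Rep.hom_ext (Representation.IntertwiningMap.ext (LinearMap.ext fun f => Subtype.ext
    (raiseFun_compLeft hU hα hfac (f : 𝒢 → V))))

/-- **The weight-raising map on cohomology** `H^i(U, τ') ⟶ H^i(U, τ)`. [cite: KhareThorne2017, §6.4] -/
abbrev raiseCohomology (hφ : ∀ δ : Δ, φ ∘ₗ τ δ = τ' δ ∘ₗ φ) (hsplit : φ ∘ₗ ψ = LinearMap.id)
    (hU : U.toSubmonoid ≤ Δ) (hα : α ∈ Δ) (hfac : HeckeFactorsThrough Δ τ U φ ψ α) (i : ℕ) :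
    cohomology ι Δ τ' U i ⟶ cohomology ι Δ τ U i :=
  groupCohomology.map (MonoidHom.id Γ) (raise ι Δ τ τ' U ψ α φ hφ hsplit hU hα hfac) i

/-- **Independence of weight, cohomological form: `φ_* ∘ Θ = [U α U]` on `H^i(U, τ')`.**
[cite: KhareThorne2017, §6.4, Prop. 6.13] -/
theorem raiseCohomology_comp_pushforwardCohomology (hφ : ∀ δ : Δ, φ ∘ₗ τ δ = τ' δ ∘ₗ φ)
    (hsplit : φ ∘ₗ ψ = LinearMap.id) (hU : U.toSubmonoid ≤ Δ) (hα : α ∈ Δ)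
    (hfac : HeckeFactorsThrough Δ τ U φ ψ α) (i : ℕ) :
    (pushforwardCohomology ι Δ τ τ' U φ hφ i).hom ∘ₗ
        (raiseCohomology ι Δ τ τ' U ψ α φ hφ hsplit hU hα hfac i).hom =
      heckeCohomology ι Δ τ' U hU hα i := by
  dsimp only [heckeCohomology, pushforwardCohomology, raiseCohomology]
  rw [← ModuleCat.hom_comp, ← groupCohomology.map_id_comp,
    raise_comp_pushforward ι Δ τ τ' U ψ α φ hφ hsplit hU hα hfac]

/-- **Independence of weight, cohomological form: `Θ ∘ φ_* = [U α U]` on `H^i(U, τ)`.**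
[cite: KhareThorne2017, §6.4, Prop. 6.13] -/
theorem pushforwardCohomology_comp_raiseCohomology (hφ : ∀ δ : Δ, φ ∘ₗ τ δ = τ' δ ∘ₗ φ)
    (hsplit : φ ∘ₗ ψ = LinearMap.id) (hU : U.toSubmonoid ≤ Δ) (hα : α ∈ Δ)
    (hfac : HeckeFactorsThrough Δ τ U φ ψ α) (i : ℕ) :
    (raiseCohomology ι Δ τ τ' U ψ α φ hφ hsplit hU hα hfac i).hom ∘ₗ
        (pushforwardCohomology ι Δ τ τ' U φ hφ i).hom =
      heckeCohomology ι Δ τ U hU hα i := by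
  dsimp only [heckeCohomology, pushforwardCohomology, raiseCohomology]
  rw [← ModuleCat.hom_comp, ← groupCohomology.map_id_comp,
    pushforward_comp_raise ι Δ τ τ' U ψ α φ hφ hsplit hU hα hfac]

/-- `Θ` commutes with `[U α U]` on cohomology (formally: `Θ U' = Θ φ_* Θ = U Θ`). [folklore] -/
theorem raiseCohomology_comp_heckeCohomology (hφ : ∀ δ : Δ, φ ∘ₗ τ δ = τ' δ ∘ₗ φ)
    (hsplit : φ ∘ₗ ψ = LinearMap.id) (hU : U.toSubmonoid ≤ Δ) (hα : α ∈ Δ)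
    (hfac : HeckeFactorsThrough Δ τ U φ ψ α) (i : ℕ) :
    (raiseCohomology ι Δ τ τ' U ψ α φ hφ hsplit hU hα hfac i).hom ∘ₗ heckeCohomology ι Δ τ' U hU hα i =
      heckeCohomology ι Δ τ U hU hα i ∘ₗ
        (raiseCohomology ι Δ τ τ' U ψ α φ hφ hsplit hU hα hfac i).hom := by
  rw [← raiseCohomology_comp_pushforwardCohomology ι Δ τ τ' U ψ α φ hφ hsplit hU hα hfac i,
    ← LinearMap.comp_assoc, pushforwardCohomology_comp_raiseCohomology]

/-- **Independence of weight (abstract form).**  On parts `X₀ ⊆ H^i(U, τ)`, `Y₀ ⊆ H^i(U, τ')`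
exchanged by `φ_*` and `Θ`, on which `[U α U]` is injective, resp. surjective — e.g. the ordinary
parts `⋂ₘ range [UαU]^m` of finite cohomology groups — `φ_*` is a bijection `X₀ ≃ Y₀` (abstract Hida
lemma `bijOn_of_comp_eq`). [cite: KhareThorne2017, §6.4, Prop. 6.13] [cite: Hida1994AIF, §2, Prop. 2.1] -/
theorem bijOn_pushforwardCohomology (hφ : ∀ δ : Δ, φ ∘ₗ τ δ = τ' δ ∘ₗ φ)
    (hsplit : φ ∘ₗ ψ = LinearMap.id) (hU : U.toSubmonoid ≤ Δ) (hα : α ∈ Δ)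
    (hfac : HeckeFactorsThrough Δ τ U φ ψ α) (i : ℕ) {X₀ : Set (cohomology ι Δ τ U i)}
    {Y₀ : Set (cohomology ι Δ τ' U i)}
    (hB : Set.MapsTo (pushforwardCohomology ι Δ τ τ' U φ hφ i).hom X₀ Y₀)
    (hA : Set.MapsTo (raiseCohomology ι Δ τ τ' U ψ α φ hφ hsplit hU hα hfac i).hom Y₀ X₀)
    (hinj : Set.InjOn (heckeCohomology ι Δ τ U hU hα i) X₀)
    (hsurj : Set.SurjOn (heckeCohomology ι Δ τ' U hU hα i) Y₀ Y₀) :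
    Set.BijOn (pushforwardCohomology ι Δ τ τ' U φ hφ i).hom X₀ Y₀ :=
  bijOn_of_comp_eq (pushforwardCohomology_comp_raiseCohomology ι Δ τ τ' U ψ α φ hφ hsplit hU hα hfac i)
    (raiseCohomology_comp_pushforwardCohomology ι Δ τ τ' U ψ α φ hφ hsplit hU hα hfac i) hB hA hinj hsurj

end Raise

end Literature.NumberTheory.Automorphic.LevelAction
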